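import Literature.AnabelianGeometry.EtaleTheta.SettingModelSec2Hyps
import HarnessLib

/-!
# The clause "`Π^tp_{Y_N} ⊇ Ker(Π^tp_Y ↠ (Π^tp_Y)^ell)`" of `ThetaSetting.Sec2Hyps` is independent of the
# [EtTh] §1 root interface: the root model with a TWISTED `Y`-lattice (kernel countermodel; no new Prop facts)

Mochizuki, *The étale theta function …*, Publ. RIMS **45** (2009) [EtTh], §1 p. 13: "an open immersion
`G_{K_N} ↪ (Π^tp_Y)^ell/N·(Δ^tp_Y)^ell` the image of which … determines a Galois covering `Y_N → Y`" — whence,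
in print, `Π^tp_{Y_N} ⊇ Ker(Π^tp_Y ↠ (Π^tp_Y)^ell)` BY CONSTRUCTION [cite: MochizukiEtTh2009, §1 p.13]; Def. 2.5
p. 39 ("`K = K̈`").

abc-iut cell, layer L2 / K-L6 slice (bundle `ThetaSetting.Sec2Hyps`, FACT-LIST F-2511), seat abc-iut-w6-d092
(gen 5); sibling of `SettingModelQNonSquare.lean` (clause (a) "`K = K̈`"). QUESTION (abc-iut-L6-lead 13:21:50Z,
abc-iut-w5-d233 16:22:17Z (b)): is clause (b) `Sec2Hyps.ker_toEll_le_GtpYN :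
∀ N, Ker(Π^tp_X ↠ (Π^tp_X)^ell) ⊓ Π^tp_Y ≤ Π^tp_{Y_N}` of abc-iut-L2-t8's record (`ThetaCyclotomes.lean`; flagged
there "TODO-merge: candidate root axiom") DERIVABLE from the root interface `ThetaSetting p` (`Setting.lean`),
which pins `Π^tp_{Y_N}` only by `GtpYN_one`, `GtpYN_le`, `map_aug_GtpYN`, normality, openness, `GtpYN_anti`,
`relIndex_deltaYN` and the `Z_N`-rows? THIS FILE answers **NO** (abc-iut-w5-d233's "countermodel shape" made
explicit): at abc-iut-L2-t1's root model (`SettingModel.lean`: `Π^tp_X := F₂ × G_{ℚ_p}`, `F₂ ↠ Heis ℤ`,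
`Δ_{Y_N} = {x = 0, N ∣ y}`, `Δ_{Z_N} = {x = 0, N ∣ y, N ∣ z}`) replace the `Y`-lattice at the levels `4 ∣ N` by

  `Δ'_{Y_N} := heisHom⁻¹ {x = 0, N/2 ∣ y, 2 ∣ z}`      (`heisYT`, `deltaYN'`, `YNt`)

and keep EVERYTHING else (`Z_N`, `q_X = p²`, `K_N`, the theta quotients). Then (`ThetaSetting.modelTwist p`):
* every root axiom holds — `Δ'_{Y_N}` is normal (conjugation moves `z` by `x'·y`, even since `4 ∣ N`), of index
  `(N/2)·2 = N` in `Δ_Y` (`Heis.relIndex_heisYT`), antitone in `N` (the arithmetic `M ∣ N, 4 ∤ M, 4 ∣ N ⇒ M ∣ N/2`,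
  `dvd_div_two_of_not_four_dvd`), contains `Δ_{Z_N}` with index `2·(N/2) = N` (`Heis.relIndex_heisZN_heisYT`),
  `Δ'_{Y_1} = Δ_Y`, Galois part `G_{K_N}`; the guard `IsEtThOrigin`, `Compat` and clause (a) "`K = K̈`" hold;
* but the commutator `⁅a, b⁆` (`heisHom ⁅a,b⁆ = (0,0,1)`) lies in `Ker(Π^tp_X ↠ (Π^tp_X)^ell) ∩ Π^tp_Y` and NOT in
  `Π'^tp_{Y_4} = {x = 0, 2 ∣ y, 2 ∣ z} × G_{K_4}`: clause (b) FAILS (`not_ker_toEll_inf_GtpY_le_GtpYN_modelTwist`).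
Hence **`ThetaSetting.not_forall_ker_toEll_inf_GtpY_le_GtpYN`**: `¬ ∀ D, D.IsEtThOrigin → D.Kdd = D.K → (b)`, and
**`ThetaSetting.not_forall_sec2Hyps_of_isEtThOrigin`**. READING (K-L6 census): clause (b) is NOT a lemma of the
root interface + guard + clause (a); it is print's CONSTRUCTION of `Y_N` (p. 13), which the root record does not
pin down — abc-iut-L2-t8's "candidate root axiom" is a genuine axiom (merging it into `Setting.lean` is a
planner's call), and the bundle `Sec2Hyps` stays a bound standing hypothesis of every §2 statement (instances:
`ThetaSetting.model_sec2Hyps`, abc-iut-w5-d233's Tate carriers). HONEST LIMITS: independence evidence about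
OUR typed interface only (the model is degenerate along the tempered topology: everything discrete); nothing of
[EtTh] is asserted or denied; no side is taken on [IUTchIII] Cor. 3.12. No instances on existing types; no Prop
facts; `modelTwist` is an explicit inhabitant of the existing structure `ThetaSetting p`.
-/

noncomputable section

namespace Literature.AnabelianGeometry.EtaleTheta.SettingModel

open Literature.AnabelianGeometry.SemiGraphs IntermediateField
open scoped commutatorElement

/-! ### Arithmetic of the twisted levels -/

/-- `M ∣ N`, `4 ∤ M`, `4 ∣ N ⇒ M ∣ N/2` (the `2`-adic valuation of `M` is at most `1`). [folklore] -/
private theorem dvd_div_two_of_not_four_dvd {M N : ℕ} (hMN : M ∣ N) (hM : ¬ 4 ∣ M) (hN : 4 ∣ N) : M ∣ N / 2 := by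
  obtain ⟨k, rfl⟩ := hN
  have h42 : 4 * k / 2 = 2 * k := by omega
  rw [h42]
  have h4k : 4 * k = 2 * (2 * k) := by ring
  rcases Nat.even_or_odd M with ⟨m, rfl⟩ | hodd
  · -- `M = 2m` with `m` odd
    have hm2 : ¬ 2 ∣ m := fun ⟨t, ht⟩ => hM ⟨t, by omega⟩
    have hcop : Nat.Coprime m 2 := ((Nat.Prime.coprime_iff_not_dvd Nat.prime_two).mpr hm2).symm
    have h1 : 2 * m ∣ 2 * (2 * k) := by rw [← h4k, two_mul]; exact hMN
    have h2 : m ∣ 2 * k := Nat.dvd_of_mul_dvd_mul_left two_pos h1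
    have h3 : m ∣ k := hcop.dvd_of_dvd_mul_left h2
    rw [← two_mul]
    exact Nat.mul_dvd_mul_left 2 h3
  · have hM2 : ¬ 2 ∣ M := by
      obtain ⟨m, rfl⟩ := hodd
      omega
    have hcop : Nat.Coprime M 2 := ((Nat.Prime.coprime_iff_not_dvd Nat.prime_two).mpr hM2).symm
    rw [h4k] at hMN
    exact hcop.dvd_of_dvd_mul_left hMN

/-- `M ∣ N`, `2 ∣ M ⇒ M/2 ∣ N/2`. [folklore] -/
private theorem div_two_dvd_div_two {M N : ℕ} (hMN : M ∣ N) (hM : 2 ∣ M) : M / 2 ∣ N / 2 := by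
  obtain ⟨t, rfl⟩ := hMN
  obtain ⟨m, rfl⟩ := hM
  rw [Nat.mul_assoc, Nat.mul_div_cancel_left _ two_pos, Nat.mul_div_cancel_left _ two_pos]
  exact Dvd.intro t rfl

/-! ### The twisted Heisenberg level `{x = 0, N/2 ∣ y, 2 ∣ z}` -/

/-- **The twisted level** `{x = 0, N/2 ∣ y, 2 ∣ z} ≤ Heis ℤ` (used at the levels `4 ∣ N`): another normal
subgroup of index `N` in `{x = 0}` containing `{x = 0, N ∣ y, N ∣ z}` with index `N` — but NOT containing the
commutator `(0,0,1)`. [cite: MochizukiEtTh2009, §1 p.13] -/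
def heisYT (N : ℕ) : Subgroup (Heis ℤ) where
  carrier := {g | g.x = 0 ∧ ((N / 2 : ℕ) : ℤ) ∣ g.y ∧ (2 : ℤ) ∣ g.z}
  one_mem' := ⟨rfl, by simp, by simp⟩
  mul_mem' := by
    rintro g h ⟨hg, hg', hg''⟩ ⟨hh, hh', hh''⟩
    refine ⟨by simp [hg, hh], by simpa using dvd_add hg' hh', ?_⟩
    simp only [Heis.mul_z, hg, zero_mul, add_zero]
    exact dvd_add hg'' hh''
  inv_mem' := by
    rintro g ⟨hg, hg', hg''⟩
    refine ⟨by simp [hg], by simpa using hg'.neg_right, ?_⟩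
    simp only [Heis.inv_z, hg, zero_mul, add_zero]
    exact hg''.neg_right

/-- For `4 ∣ N` the twisted level is normal in `Heis ℤ`: conjugating `(0,y,z)` by `(x',y',z')` gives
`(0, y, z + x'·y)` and `y` is even. [cite: MochizukiEtTh2009, §1 p.13] -/
theorem heisYT_normal {N : ℕ} (h4 : 4 ∣ N) : (heisYT N).Normal := by
  have h2 : (2 : ℤ) ∣ ((N / 2 : ℕ) : ℤ) := by
    obtain ⟨k, rfl⟩ := h4
    exact ⟨k, by omega⟩
  refine ⟨fun g ⟨hg, hg', hg''⟩ h => ⟨by simp [hg], by simpa using hg', ?_⟩⟩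
  have : (h * g * h⁻¹).z = g.z + h.x * g.y := by simp [hg]; ring
  show (2 : ℤ) ∣ (h * g * h⁻¹).z
  rw [this]
  exact dvd_add hg'' ((h2.trans hg').mul_left _)

/-- `{x = 0, N/2 ∣ y, 2 ∣ z} ≤ {x = 0}`. [cite: MochizukiEtTh2009, §1 p.13] -/
theorem heisYT_le_heisYN_one (N : ℕ) : heisYT N ≤ heisYN 1 := by
  rintro g ⟨hg, -, -⟩
  exact ⟨hg, by simp⟩

/-- `{x = 0, N ∣ y, N ∣ z} ≤ {x = 0, N/2 ∣ y, 2 ∣ z}` for even `N`. [cite: MochizukiEtTh2009, §1 p.14] -/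
theorem heisZN_le_heisYT {N : ℕ} (h2 : 2 ∣ N) : heisZN N ≤ heisYT N := by
  rintro g ⟨hg, hg', hg''⟩
  have h2' : (2 : ℤ) ∣ (N : ℤ) := by exact_mod_cast h2
  exact ⟨hg, (Int.natCast_dvd_natCast.mpr (Nat.div_dvd_of_dvd h2)).trans hg', h2'.trans hg''⟩

/-- The twisted levels are antitone among themselves: `M ∣ N`, `2 ∣ M ⇒ {N/2 ∣ y} ⊆ {M/2 ∣ y}`.
[cite: MochizukiEtTh2009, §1 p.18] -/
theorem heisYT_anti {M N : ℕ} (hMN : M ∣ N) (hM : 2 ∣ M) : heisYT N ≤ heisYT M := by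
  rintro g ⟨hg, hg', hg''⟩
  exact ⟨hg, (Int.natCast_dvd_natCast.mpr (div_two_dvd_div_two hMN hM)).trans hg', hg''⟩

/-- A twisted level lies in the untwisted ones below it: `M ∣ N`, `4 ∤ M`, `4 ∣ N ⇒ {N/2 ∣ y} ⊆ {M ∣ y}`.
[cite: MochizukiEtTh2009, §1 p.18] -/
theorem heisYT_le_heisYN {M N : ℕ} (hMN : M ∣ N) (hM : ¬ 4 ∣ M) (hN : 4 ∣ N) : heisYT N ≤ heisYN M := by
  rintro g ⟨hg, hg', -⟩
  exact ⟨hg, (Int.natCast_dvd_natCast.mpr (dvd_div_two_of_not_four_dvd hMN hM hN)).trans hg'⟩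

/-- `(y mod N/2, z mod 2)` on `{x = 0}` — a homomorphism (the twist `x·y'` of `z` vanishes there).
[cite: MochizukiEtTh2009, §1 p.12] -/
def Heis.yzHom (N : ℕ) : heisYN 1 →* Multiplicative (ZMod (N / 2)) × Multiplicative (ZMod 2) where
  toFun g := (Multiplicative.ofAdd ((g.1.y : ℤ) : ZMod (N / 2)), Multiplicative.ofAdd ((g.1.z : ℤ) : ZMod 2))
  map_one' := by simp
  map_mul' g h := by
    have hg : g.1.x = 0 := g.2.1
    refine Prod.ext ?_ ?_
    · show Multiplicative.ofAdd (((g.1 * h.1).y : ℤ) : ZMod (N / 2)) =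
        Multiplicative.ofAdd ((g.1.y : ℤ) : ZMod (N / 2)) * Multiplicative.ofAdd ((h.1.y : ℤ) : ZMod (N / 2))
      rw [Heis.mul_y, Int.cast_add, ofAdd_add]
    · show Multiplicative.ofAdd (((g.1 * h.1).z : ℤ) : ZMod 2) =
        Multiplicative.ofAdd ((g.1.z : ℤ) : ZMod 2) * Multiplicative.ofAdd ((h.1.z : ℤ) : ZMod 2)
      rw [Heis.mul_z, hg, zero_mul, add_zero, Int.cast_add, ofAdd_add]

/-- **`[{x = 0} : {x = 0, N/2 ∣ y, 2 ∣ z}] = (N/2)·2 = N`** for even `N`. [cite: MochizukiEtTh2009, §1 p.16] -/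
theorem Heis.relIndex_heisYT {N : ℕ} (h2 : 2 ∣ N) : (heisYT N).relIndex (heisYN 1) = N := by
  have hker : (heisYT N).subgroupOf (heisYN 1) = (Heis.yzHom N).ker := by
    ext g
    simp only [Subgroup.mem_subgroupOf, MonoidHom.mem_ker, Heis.yzHom, MonoidHom.coe_mk,
      OneHom.coe_mk, Prod.mk_eq_one, ofAdd_eq_one, ZMod.intCast_zmod_eq_zero_iff_dvd, Nat.cast_ofNat]
    exact ⟨fun h => ⟨h.2.1, h.2.2⟩, fun h => ⟨g.2.1, h.1, h.2⟩⟩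
  have hsurj : Function.Surjective (Heis.yzHom N) := by
    rintro ⟨a, b⟩
    obtain ⟨y, hy⟩ := ZMod.intCast_surjective (Multiplicative.toAdd a)
    obtain ⟨z, hz⟩ := ZMod.intCast_surjective (Multiplicative.toAdd b)
    exact ⟨⟨⟨0, y, z⟩, rfl, by simp⟩, Prod.ext (by simp [Heis.yzHom, hy]) (by simp [Heis.yzHom, hz])⟩
  rw [Subgroup.relIndex, hker, Subgroup.index_ker, MonoidHom.range_eq_top.mpr hsurj, Subgroup.card_top,
    Nat.card_prod]
  show Nat.card (ZMod (N / 2)) * Nat.card (ZMod 2) = N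
  rw [Nat.card_zmod, Nat.card_zmod]
  exact Nat.div_mul_cancel h2

/-- `(y/(N/2) mod 2, z/2 mod N/2)` on the twisted level `{x = 0, N/2 ∣ y, 2 ∣ z}` — a homomorphism.
[cite: MochizukiEtTh2009, §1 p.14] -/
def Heis.twistQuotHom (N : ℕ) : heisYT N →* Multiplicative (ZMod 2) × Multiplicative (ZMod (N / 2)) where
  toFun g := (Multiplicative.ofAdd (((g.1.y / ((N / 2 : ℕ) : ℤ) : ℤ)) : ZMod 2),
    Multiplicative.ofAdd (((g.1.z / 2 : ℤ)) : ZMod (N / 2)))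
  map_one' := by simp
  map_mul' g h := by
    have hgx : g.1.x = 0 := g.2.1
    refine Prod.ext ?_ ?_
    · show Multiplicative.ofAdd ((((g.1 * h.1).y / ((N / 2 : ℕ) : ℤ) : ℤ)) : ZMod 2) =
        Multiplicative.ofAdd (((g.1.y / ((N / 2 : ℕ) : ℤ) : ℤ)) : ZMod 2) *
          Multiplicative.ofAdd (((h.1.y / ((N / 2 : ℕ) : ℤ) : ℤ)) : ZMod 2)
      rw [Heis.mul_y, Int.add_ediv_of_dvd_left g.2.2.1, Int.cast_add, ofAdd_add]
    · show Multiplicative.ofAdd ((((g.1 * h.1).z / 2 : ℤ)) : ZMod (N / 2)) =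
        Multiplicative.ofAdd (((g.1.z / 2 : ℤ)) : ZMod (N / 2)) * Multiplicative.ofAdd (((h.1.z / 2 : ℤ)) : ZMod (N / 2))
      rw [Heis.mul_z, hgx, zero_mul, add_zero, Int.add_ediv_of_dvd_left g.2.2.2, Int.cast_add, ofAdd_add]

/-- **`[{x = 0, N/2 ∣ y, 2 ∣ z} : {x = 0, N ∣ y, N ∣ z}] = 2·(N/2) = N`** for even `N ≠ 0`.
[cite: MochizukiEtTh2009, §1 p.14] -/
theorem Heis.relIndex_heisZN_heisYT {N : ℕ} (h2 : 2 ∣ N) (hN : N ≠ 0) :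
    (heisZN N).relIndex (heisYT N) = N := by
  have hNc : (N : ℤ) = 2 * ((N / 2 : ℕ) : ℤ) := by exact_mod_cast (Nat.mul_div_cancel' h2).symm
  have hc0 : ((N / 2 : ℕ) : ℤ) ≠ 0 := by
    have h2c : 2 * (N / 2) = N := Nat.mul_div_cancel' h2
    have : N / 2 ≠ 0 := fun h0 => hN (by rw [← h2c, h0])
    exact_mod_cast this
  have hker : (heisZN N).subgroupOf (heisYT N) = (Heis.twistQuotHom N).ker := by
    ext g
    obtain ⟨hx, ⟨u, hu⟩, ⟨v, hv⟩⟩ := g.2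
    have hyu : g.1.y / ((N / 2 : ℕ) : ℤ) = u := by rw [hu, Int.mul_ediv_cancel_left _ hc0]
    have hzv : g.1.z / 2 = v := by rw [hv, Int.mul_ediv_cancel_left _ two_ne_zero]
    simp only [Subgroup.mem_subgroupOf, MonoidHom.mem_ker, Heis.twistQuotHom, MonoidHom.coe_mk,
      OneHom.coe_mk, Prod.mk_eq_one, ofAdd_eq_one, ZMod.intCast_zmod_eq_zero_iff_dvd, Nat.cast_ofNat,
      hyu, hzv]
    constructor
    · rintro ⟨-, hNy, hNz⟩
      rw [hNc] at hNy hNz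
      rw [hu, mul_comm (2 : ℤ)] at hNy
      rw [hv] at hNz
      exact ⟨(mul_dvd_mul_iff_left hc0).mp hNy, (mul_dvd_mul_iff_left two_ne_zero).mp hNz⟩
    · rintro ⟨h2u, hcv⟩
      refine ⟨hx, ?_, ?_⟩
      · rw [hNc, hu, mul_comm (2 : ℤ)]
        exact (mul_dvd_mul_iff_left hc0).mpr h2u
      · rw [hNc, hv]
        exact (mul_dvd_mul_iff_left two_ne_zero).mpr hcv
  have hsurj : Function.Surjective (Heis.twistQuotHom N) := by
    rintro ⟨a, b⟩
    obtain ⟨u, hu⟩ := ZMod.intCast_surjective (Multiplicative.toAdd a)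
    obtain ⟨v, hv⟩ := ZMod.intCast_surjective (Multiplicative.toAdd b)
    refine ⟨⟨⟨0, ((N / 2 : ℕ) : ℤ) * u, 2 * v⟩, rfl, Dvd.intro u rfl, Dvd.intro v rfl⟩, Prod.ext ?_ ?_⟩
    · show Multiplicative.ofAdd (((((N / 2 : ℕ) : ℤ) * u / ((N / 2 : ℕ) : ℤ) : ℤ)) : ZMod 2) = a
      rw [Int.mul_ediv_cancel_left _ hc0, hu]
      rfl
    · show Multiplicative.ofAdd (((2 * v / 2 : ℤ)) : ZMod (N / 2)) = b
      rw [Int.mul_ediv_cancel_left _ two_ne_zero, hv]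
      rfl
  rw [Subgroup.relIndex, hker, Subgroup.index_ker, MonoidHom.range_eq_top.mpr hsurj, Subgroup.card_top,
    Nat.card_prod]
  show Nat.card (ZMod 2) * Nat.card (ZMod (N / 2)) = N
  rw [Nat.card_zmod, Nat.card_zmod]
  exact Nat.mul_div_cancel' h2

/-! ### The twisted family `Δ'_{Y_N}` (twist only at the levels `4 ∣ N`) -/

/-- The twisted Heisenberg `Y`-family: the twisted level where `4 ∣ N`, the original `{x = 0, N ∣ y}` else.
[cite: MochizukiEtTh2009, §1 p.13] -/
def heisYN' (N : ℕ) : Subgroup (Heis ℤ) := if 4 ∣ N then heisYT N else heisYN N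

/-- [cite: MochizukiEtTh2009, §1 p.13] -/
theorem heisYN'_of_dvd {N : ℕ} (h : 4 ∣ N) : heisYN' N = heisYT N := if_pos h

/-- [cite: MochizukiEtTh2009, §1 p.13] -/
theorem heisYN'_of_not_dvd {N : ℕ} (h : ¬ 4 ∣ N) : heisYN' N = heisYN N := if_neg h

/-- `4 ∣ N ⇒ 2 ∣ N`. [folklore] -/
private theorem two_dvd_of_four_dvd {N : ℕ} (h : 4 ∣ N) : 2 ∣ N := dvd_trans ⟨2, rfl⟩ h

/-- The twisted family at level `1` is `{x = 0}`. [cite: MochizukiEtTh2009, §1 p.14] -/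
theorem heisYN'_one : heisYN' 1 = heisYN 1 := heisYN'_of_not_dvd (by decide)

/-- `heisYN' N ≤ {x = 0}`. [cite: MochizukiEtTh2009, §1 p.13] -/
theorem heisYN'_le (N : ℕ) : heisYN' N ≤ heisYN 1 := by
  by_cases h : 4 ∣ N
  · rw [heisYN'_of_dvd h]; exact heisYT_le_heisYN_one N
  · rw [heisYN'_of_not_dvd h]
    rintro g ⟨hg, -⟩
    exact ⟨hg, by simp⟩

/-- `{x = 0, N ∣ y, N ∣ z} ≤ heisYN' N`. [cite: MochizukiEtTh2009, §1 p.14] -/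
theorem heisZN_le_heisYN' (N : ℕ) : heisZN N ≤ heisYN' N := by
  by_cases h : 4 ∣ N
  · rw [heisYN'_of_dvd h]; exact heisZN_le_heisYT (two_dvd_of_four_dvd h)
  · rw [heisYN'_of_not_dvd h]
    rintro g ⟨hg, hg', -⟩
    exact ⟨hg, hg'⟩

/-- The twisted family is normal. [cite: MochizukiEtTh2009, §1 p.14] -/
theorem heisYN'_normal (N : ℕ) : (heisYN' N).Normal := by
  by_cases h : 4 ∣ N
  · rw [heisYN'_of_dvd h]; exact heisYT_normal h
  · rw [heisYN'_of_not_dvd h]; exact heisYN_normal N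

/-- **The twisted family is antitone**: `M ∣ N ⇒ heisYN' N ≤ heisYN' M` (four cases on `4 ∣ M`, `4 ∣ N`).
[cite: MochizukiEtTh2009, §1 p.18] -/
theorem heisYN'_anti {M N : ℕ} (hMN : M ∣ N) : heisYN' N ≤ heisYN' M := by
  by_cases hM : 4 ∣ M
  · have hN : 4 ∣ N := hM.trans hMN
    rw [heisYN'_of_dvd hM, heisYN'_of_dvd hN]
    exact heisYT_anti hMN (two_dvd_of_four_dvd hM)
  · rw [heisYN'_of_not_dvd hM]
    by_cases hN : 4 ∣ N
    · rw [heisYN'_of_dvd hN]; exact heisYT_le_heisYN hMN hM hN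
    · rw [heisYN'_of_not_dvd hN]
      rintro g ⟨hg, hg'⟩
      exact ⟨hg, (Int.natCast_dvd_natCast.mpr hMN).trans hg'⟩

/-- `[{x = 0} : heisYN' N] = N`. [cite: MochizukiEtTh2009, §1 p.16] -/
theorem Heis.relIndex_heisYN' (N : ℕ) : (heisYN' N).relIndex (heisYN 1) = N := by
  by_cases h : 4 ∣ N
  · rw [heisYN'_of_dvd h]; exact Heis.relIndex_heisYT (two_dvd_of_four_dvd h)
  · rw [heisYN'_of_not_dvd h]; exact Heis.relIndex_heisYN N

/-- `[heisYN' N : {x = 0, N ∣ y, N ∣ z}] = N` (`N ≠ 0`). [cite: MochizukiEtTh2009, §1 p.14] -/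
theorem Heis.relIndex_heisZN_heisYN' {N : ℕ} (hN : N ≠ 0) : (heisZN N).relIndex (heisYN' N) = N := by
  by_cases h : 4 ∣ N
  · rw [heisYN'_of_dvd h]; exact Heis.relIndex_heisZN_heisYT (two_dvd_of_four_dvd h) hN
  · rw [heisYN'_of_not_dvd h]; exact Heis.relIndex_heisZN N

/-- `Δ'_{Y_N} ≤ F₂`: the twisted `Y`-family pulled back along `F₂ ↠ Heis ℤ`. [cite: MochizukiEtTh2009, §1 p.13] -/
def deltaYN' (N : ℕ) : Subgroup F₂ := (heisYN' N).comap heisHom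

/-- `Δ'_{Y_1} = Δ_Y`. [cite: MochizukiEtTh2009, §1 p.14] -/
theorem deltaYN'_one : deltaYN' 1 = deltaY := by
  rw [deltaYN', heisYN'_one, ← deltaYN_one]
  rfl

/-- `Δ'_{Y_N} ≤ Δ_Y`. [cite: MochizukiEtTh2009, §1 p.13] -/
theorem deltaYN'_le_deltaY (N : ℕ) : deltaYN' N ≤ deltaY := by
  rw [← deltaYN_one]
  exact Subgroup.comap_mono (heisYN'_le N)

/-- `Δ_{Z_N} ≤ Δ'_{Y_N}`. [cite: MochizukiEtTh2009, §1 p.14] -/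
theorem deltaZN_le_deltaYN' (N : ℕ) : deltaZN N ≤ deltaYN' N :=
  Subgroup.comap_mono (heisZN_le_heisYN' N)

/-- `Δ'_{Y_N}` is normal in `F₂`. [cite: MochizukiEtTh2009, §1 p.14] -/
theorem deltaYN'_normal (N : ℕ) : (deltaYN' N).Normal := by
  haveI := heisYN'_normal N
  exact Subgroup.Normal.comap inferInstance _

/-- `Δ'_{Y_N} ≤ Δ'_{Y_M}` for `M ∣ N`. [cite: MochizukiEtTh2009, §1 p.18] -/
theorem deltaYN'_anti {M N : ℕ} (h : M ∣ N) : deltaYN' N ≤ deltaYN' M :=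
  Subgroup.comap_mono (heisYN'_anti h)

/-- **`[Δ_Y : Δ'_{Y_N}] = N`**. [cite: MochizukiEtTh2009, §1 p.16] -/
theorem relIndex_deltaYN' (N : ℕ) : (deltaYN' N).relIndex (deltaYN 1) = N := by
  rw [deltaYN', deltaYN, Subgroup.relIndex_comap,
    Subgroup.map_comap_eq_self_of_surjective heisHom_surjective, Heis.relIndex_heisYN']

/-- **`[Δ'_{Y_N} : Δ_{Z_N}] = N`** (`N ≠ 0`). [cite: MochizukiEtTh2009, §1 p.14] -/
theorem relIndex_deltaZN_deltaYN' {N : ℕ} (hN : N ≠ 0) : (deltaZN N).relIndex (deltaYN' N) = N := by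
  rw [deltaZN, deltaYN', Subgroup.relIndex_comap,
    Subgroup.map_comap_eq_self_of_surjective heisHom_surjective, Heis.relIndex_heisZN_heisYN' hN]

/-- **The twist bites at `N = 4`**: `⁅a, b⁆ ∉ Δ'_{Y_4}` (`heisHom ⁅a,b⁆ = (0,0,1)`, `z = 1` odd), although
`⁅a, b⁆ ∈ [F₂, F₂] ⊆ Ker(F₂ → (Δ^tp_X)^ell)`. [cite: MochizukiEtTh2009, §1 p.13] -/
theorem commutator_not_mem_deltaYN'_four :
    ⁅FreeGroup.of (0 : Fin 2), FreeGroup.of 1⁆ ∉ deltaYN' 4 := by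
  intro h
  rw [deltaYN', Subgroup.mem_comap, heisHom_commutator, heisYN'_of_dvd (dvd_refl 4)] at h
  obtain ⟨-, -, h2⟩ := h
  change (2 : ℤ) ∣ 1 at h2
  omega

/-! ### The twisted coverings `Π'^tp_{Y_N} := Δ'_{Y_N} × G_{K_N}` over the root model's `Γ`, `K_N`, `Z_N` -/

variable (p : ℕ) [Fact p.Prime]

/-- `p² ∈ ℚ_p`. [folklore] -/
private theorem qModel_mem_bot' : qModel p ∈ (⊥ : IntermediateField ℚ_[p] (PadicAlgCl p)) := by
  unfold qModel
  exact pow_mem (IntermediateField.natCast_mem _ p) 2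

/-- `p² ≠ 0`. [folklore] -/
private theorem qModel_ne_zero' : qModel p ≠ 0 := by
  unfold qModel
  exact pow_ne_zero 2 (Nat.cast_ne_zero.mpr (Fact.out : p.Prime).ne_zero)

/-- The augmentation carries `A × B` onto `B`. [folklore] -/
private theorem map_aug_prod'' (A : Subgroup Del) (B : Subgroup (GQp p)) :
    (A.prod (B.comap (Gam.toGQp p).toMonoidHom)).map (curve p).aug.toMonoidHom = B := by
  ext σ
  constructor
  · rintro ⟨x, ⟨-, hx⟩, rfl⟩
    exact hx
  · intro hσ
    exact ⟨((1 : Del), (σ : Gam p)), ⟨A.one_mem, hσ⟩, rfl⟩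

/-- `Δ^tp_X ∩ (A × B) = A × 1`. [folklore] -/
private theorem prod_inf_deltaTemp'' (A : Subgroup Del) (B : Subgroup (Gam p)) :
    A.prod B ⊓ (curve p).aug.toMonoidHom.ker = A.prod ⊥ := by
  ext g
  rw [Subgroup.mem_inf, Subgroup.mem_prod, Subgroup.mem_prod, Subgroup.mem_bot]
  constructor
  · rintro ⟨⟨h1, -⟩, h3⟩
    exact ⟨h1, (mem_deltaTemp_iff p g).mp h3⟩
  · rintro ⟨h1, h2⟩
    exact ⟨⟨h1, by rw [h2]; exact B.one_mem⟩, (mem_deltaTemp_iff p g).mpr h2⟩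

/-- `[A × 1 : A' × 1] = [A : A']`, computed in `F₂`. [folklore] -/
private theorem relIndex_prod_bot'' (A' A : Subgroup F₂) :
    ((A'.comap Del.val).prod (⊥ : Subgroup (Gam p))).relIndex ((A.comap Del.val).prod ⊥) =
      A'.relIndex A := by
  have h1 : ∀ B : Subgroup Del, B.prod (⊥ : Subgroup (Gam p)) = B.map (MonoidHom.inl Del (Gam p)) := by
    intro B
    ext x
    constructor
    · rintro ⟨hx1, hx2⟩
      exact ⟨x.1, hx1, Prod.ext rfl ((Subgroup.mem_bot.mp hx2).symm)⟩
    · rintro ⟨b, hb, rfl⟩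
      exact ⟨hb, Subgroup.mem_bot.mpr rfl⟩
  have hinj : Function.Injective (MonoidHom.inl Del (Gam p)) := fun a b h => congrArg Prod.fst h
  have h2 := Subgroup.relIndex_comap ((A'.comap Del.val).map (MonoidHom.inl Del (Gam p)))
    (MonoidHom.inl Del (Gam p)) (A.comap Del.val)
  rw [Subgroup.comap_map_eq_self_of_injective hinj] at h2
  rw [h1, h1, ← h2, Subgroup.relIndex_comap, Subgroup.map_comap_eq_self_of_surjective
    Del.val_bijective.2]

/-- **`Π'^tp_{Y_N} := Δ'_{Y_N} × G_{K_N}`** — the twisted `Y`-covering groups over the root model's Galois side.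
[cite: MochizukiEtTh2009, §1 p.13] -/
def YNt (N : ℕ+) : Subgroup (PiTp p) := ((deltaYN' N).comap Del.val).prod (gKN p N)

/-- `Π'^tp_{Y_1} = Π^tp_Y`. [cite: MochizukiEtTh2009, §1 p.14] -/
theorem YNt_one : YNt p 1 = (toZM p).ker := by
  rw [ker_toZM, YNt, PNat.one_coe, deltaYN'_one, gKN, fieldKN_bot_one _ (qModel_mem_bot' p),
    IntermediateField.fixingSubgroup_bot, Subgroup.comap_top]

/-- `Π'^tp_{Y_N} ≤ Π^tp_Y`. [cite: MochizukiEtTh2009, §1 p.13] -/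
theorem YNt_le (N : ℕ+) : YNt p N ≤ (toZM p).ker := by
  rw [ker_toZM]
  exact Subgroup.prod_mono (Subgroup.comap_mono (deltaYN'_le_deltaY N)) le_top

/-- The image of `Π'^tp_{Y_N}` in `G_{ℚ_p}` is `G_{K_N}`. [cite: MochizukiEtTh2009, §1 p.13] -/
theorem map_aug_YNt (N : ℕ+) :
    (YNt p N).map (curve p).aug.toMonoidHom = (fieldKN ⊥ (qModel p) N).fixingSubgroup :=
  map_aug_prod'' p _ _

/-- `Π'^tp_{Y_N}` is normal in `Π^tp_X`. [cite: MochizukiEtTh2009, §1 p.14] -/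
theorem YNt_normal (N : ℕ+) : (YNt p N).Normal := by
  haveI := deltaYN'_normal N
  haveI := fixingSubgroup_fieldKN_bot_normal _ (qModel_mem_bot' p) N
  haveI : ((deltaYN' N).comap Del.val).Normal := Subgroup.Normal.comap inferInstance _
  haveI : (gKN p N).Normal := Subgroup.Normal.comap inferInstance _
  exact Subgroup.prod_normal _ _

/-- `Π'^tp_{Y_N} ≤ Π'^tp_{Y_M}` for `M ∣ N`. [cite: MochizukiEtTh2009, §1 p.18] -/
theorem YNt_anti (M N : ℕ+) (h : (M : ℕ) ∣ N) : YNt p N ≤ YNt p M :=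
  Subgroup.prod_mono (Subgroup.comap_mono (deltaYN'_anti h))
    (Subgroup.comap_mono (IntermediateField.fixingSubgroup_antitone
      (fieldKN_bot_mono _ (qModel_ne_zero' p) h)))

/-- **`[Δ^tp_Y : Δ'^tp_{Y_N}] = N`**. [cite: MochizukiEtTh2009, §1 p.16] -/
theorem relIndex_YNt (N : ℕ+) :
    (YNt p N ⊓ (curve p).aug.toMonoidHom.ker).relIndex ((toZM p).ker ⊓ (curve p).aug.toMonoidHom.ker) =
      N := by
  rw [ker_toZM, YNt, prod_inf_deltaTemp'', prod_inf_deltaTemp'', ← deltaYN_one, relIndex_prod_bot'',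
    relIndex_deltaYN']

/-- `Π^tp_{Z_N} ≤ Π'^tp_{Y_N}` (the root model's `Z_N`). [cite: MochizukiEtTh2009, §1 p.14] -/
theorem ZN_le_YNt (N : ℕ+) : ZN p N ≤ YNt p N :=
  Subgroup.prod_mono (Subgroup.comap_mono (deltaZN_le_deltaYN' N))
    (Subgroup.comap_mono (IntermediateField.fixingSubgroup_antitone (fieldKN_le_fieldJN _ ⊥ N)))

/-- **`[Δ'^tp_{Y_N} : Δ^tp_{Z_N}] = N`**. [cite: MochizukiEtTh2009, §1 p.14] -/
theorem relIndex_ZN_YNt (N : ℕ+) :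
    (ZN p N ⊓ (curve p).aug.toMonoidHom.ker).relIndex (YNt p N ⊓ (curve p).aug.toMonoidHom.ker) = N := by
  rw [ZN, YNt, prod_inf_deltaTemp'', prod_inf_deltaTemp'', relIndex_prod_bot'',
    relIndex_deltaZN_deltaYN' N.ne_zero]

/-- `Ker(Π^tp_X ↠ (Π^tp_X)^Θ) ∩ Π'^tp_{Y_N} ≤ Π^tp_{Z_N}` (the class-2 shadow: the kernel already lies in
`Ker(F₂ → Heis ℤ) × 1 ≤ Π^tp_{Z_N}`). [cite: MochizukiEtTh2009, §1 p.14] -/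
theorem ker_toThetaM_inf_YNt_le_ZN (N : ℕ+) : (toThetaM p).ker ⊓ YNt p N ≤ ZN p N := by
  rintro g ⟨hg, -⟩
  rw [toThetaM, QuotientGroup.ker_mk'] at hg
  obtain ⟨h1, h2⟩ := heisHom_eq_one_and_snd_eq_one_of_mem_KTheta p hg
  refine ⟨ker_heisHom_le_deltaZN N h1, ?_⟩
  show g.2 ∈ gJN p N
  rw [h2]
  exact (gJN p N).one_mem

/-! ### The inhabitant `ThetaSetting.modelTwist p` and the failure of clause (b) -/

/-- **The root model with the twisted `Y`-lattice.** abc-iut-L2-t1's `ThetaSetting.model p` with `GtpYN`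
replaced by `Π'^tp_{Y_N} = Δ'_{Y_N} × G_{K_N}` (twisted at `4 ∣ N`), everything else — `K`, `q_X = p²`, `q̈ = p`,
`Π^tp_X ↠ Z`, the theta quotients, `Z_N` — unchanged. Consistency / independence evidence only.
[cite: MochizukiEtTh2009, §1 p.13] -/
abbrev _root_.Literature.AnabelianGeometry.EtaleTheta.ThetaSetting.modelTwist : ThetaSetting p where
  toTemperedCurve := curve p
  qX := qModel p
  qX_mem := qModel_mem_bot' p
  norm_qX_lt_one := (ThetaSetting.model p).norm_qX_lt_one
  qX_ne_zero := qModel_ne_zero' p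
  sqrtqX := ((p : ℕ) : PadicAlgCl p)
  sqrtqX_sq := rfl
  toZ := toZM p
  toZ_surjective := toZM_surjective p
  isOpen_ker_toZ := isOpen_discrete _
  toZ_delta_surjective := toZM_delta_surjective p
  GtpTheta := GTheta p
  toTheta := toThetaM p
  continuous_toTheta := continuous_of_discreteTopology
  toTheta_surjective := QuotientGroup.mk'_surjective _
  ker_toTheta := QuotientGroup.ker_mk' _
  GtpEll := GEll p
  thetaToEll := thetaToEllM p
  continuous_thetaToEll := (ThetaSetting.model p).continuous_thetaToEll
  thetaToEll_surjective := (ThetaSetting.model p).thetaToEll_surjective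
  ker_toEll := ker_toEllM p
  ker_thetaToEll_comm := ker_thetaToEllM_comm p
  ker_thetaToEll_central := ker_thetaToEllM_central p
  GtpYN := YNt p
  GtpYN_one := YNt_one p
  GtpYN_le := YNt_le p
  map_aug_GtpYN := map_aug_YNt p
  GtpYN_normal := YNt_normal p
  isOpen_GtpYN _ := isOpen_discrete _
  GtpYN_anti := YNt_anti p
  relIndex_deltaYN := relIndex_YNt p
  GtpZN := ZN p
  GtpZN_le := ZN_le_YNt p
  map_aug_GtpZN := map_aug_ZN p
  GtpZN_normal := ZN_normal p
  isOpen_GtpZN _ := isOpen_discrete _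
  GtpZN_anti := ZN_anti p
  relIndex_deltaZN := relIndex_ZN_YNt p
  ker_toTheta_le_GtpZN := ker_toThetaM_inf_YNt_le_ZN p

/-- `modelTwist` satisfies the vacuity guard `IsEtThOrigin`. [cite: MochizukiEtTh2009, §1 p.12] -/
theorem _root_.Literature.AnabelianGeometry.EtaleTheta.ThetaSetting.modelTwist_isEtThOrigin :
    (ThetaSetting.modelTwist p).IsEtThOrigin :=
  ThetaSetting.IsEtThOrigin.of_free (isFreeProfiniteOnTwo_deltaHat p)

/-- `modelTwist` satisfies `Compat` (abc-iut `ThetaSetting.compat`). [cite: MochizukiEtTh2009, §1 p.22] -/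
theorem _root_.Literature.AnabelianGeometry.EtaleTheta.ThetaSetting.modelTwist_compat :
    (ThetaSetting.modelTwist p).Compat :=
  (ThetaSetting.modelTwist p).compat

/-- **Clause (a) "`K = K̈`" HOLDS at `modelTwist`** (`K := ℚ_p`, `q_X := p²`; abc-iut-L2-d1's
`fieldKN_bot_two_of_sq`). [cite: MochizukiEtTh2009, Def 2.5 p.39] -/
theorem modelTwist_Kdd_eq : (ThetaSetting.modelTwist p).Kdd = (ThetaSetting.modelTwist p).K := by
  change fieldKN ⊥ (qModel p) 2 = ⊥
  exact fieldKN_bot_two_of_sq p (IntermediateField.natCast_mem _ p)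

/-- The commutator `(⁅a, b⁆, 1) ∈ Π^tp_X = Δ × Γ`. [cite: MochizukiEtTh2009, §1 p.12] -/
def commAB : PiTp p := (Del.ofF₂ ⁅FreeGroup.of (0 : Fin 2), FreeGroup.of 1⁆, 1)

/-- `(⁅a,b⁆, 1) ∈ Ker(Π^tp_X ↠ (Π^tp_X)^ell)` (vanishing exponent sums, trivial Galois part: abc-iut-L2-t1's
class-1 shadow). [cite: MochizukiEtTh2009, §1 p.12] -/
theorem commAB_mem_KEll : commAB p ∈ KEll p := by
  refine (mem_KEll_iff_of_snd_eq_one p rfl).mpr ?_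
  change (heisHom ⁅FreeGroup.of (0 : Fin 2), FreeGroup.of 1⁆).x = 0 ∧
    (heisHom ⁅FreeGroup.of (0 : Fin 2), FreeGroup.of 1⁆).y = 0
  rw [heisHom_commutator]
  exact ⟨rfl, rfl⟩

/-- `(⁅a,b⁆, 1) ∈ Π^tp_Y = Ker(Π^tp_X ↠ Z)`. [cite: MochizukiEtTh2009, §1 p.12] -/
theorem commAB_mem_ker_toZM : commAB p ∈ (toZM p).ker := by
  rw [MonoidHom.mem_ker, toZM_apply]
  change Multiplicative.ofAdd (heisHom ⁅FreeGroup.of (0 : Fin 2), FreeGroup.of 1⁆).x = 1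
  rw [heisHom_commutator]
  rfl

/-- **`(⁅a,b⁆, 1) ∉ Π'^tp_{Y_4}`**. [cite: MochizukiEtTh2009, §1 p.13] -/
theorem commAB_not_mem_YNt_four : commAB p ∉ YNt p 4 := fun h =>
  commutator_not_mem_deltaYN'_four h.1

/-- **Clause (b) of `Sec2Hyps` FAILS at `modelTwist`**: `Ker(Π^tp_X ↠ (Π^tp_X)^ell) ∩ Π^tp_Y ⊄ Π'^tp_{Y_4}`.
[cite: MochizukiEtTh2009, §1 p.13] -/
theorem not_ker_toEll_inf_GtpY_le_GtpYN_modelTwist :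
    ¬ ∀ N, ((ThetaSetting.modelTwist p).thetaToEll.comp (ThetaSetting.modelTwist p).toTheta).ker ⊓
      (ThetaSetting.modelTwist p).GtpY ≤ (ThetaSetting.modelTwist p).GtpYN N := by
  intro h
  have hmem : commAB p ∈
      ((ThetaSetting.modelTwist p).thetaToEll.comp (ThetaSetting.modelTwist p).toTheta).ker ⊓
        (ThetaSetting.modelTwist p).GtpY := by
    refine ⟨?_, commAB_mem_ker_toZM p⟩
    change commAB p ∈ ((thetaToEllM p).comp (toThetaM p)).ker
    rw [ker_toEllM]
    exact commAB_mem_KEll p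
  exact commAB_not_mem_YNt_four p (h 4 hmem)

/-- **`modelTwist` does NOT satisfy `Sec2Hyps`** (clause (b) fails). [cite: MochizukiEtTh2009, §1 p.13] -/
theorem _root_.Literature.AnabelianGeometry.EtaleTheta.ThetaSetting.not_sec2Hyps_modelTwist :
    ¬ (ThetaSetting.modelTwist p).Sec2Hyps :=
  fun h => not_ker_toEll_inf_GtpY_le_GtpYN_modelTwist p h.ker_toEll_le_GtpYN

/-- **UNIVERSAL CLOSURE OF CLAUSE (b) REFUTED, sharply**: "`Π^tp_{Y_N} ⊇ Ker(Π^tp_Y ↠ (Π^tp_Y)^ell)` for all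
`N`" is NOT a consequence of the root interface `ThetaSetting p`, its guard `IsEtThOrigin` and clause (a)
"`K = K̈`" — it is an independent axiom on the data `GtpYN` (print's construction of `Y_N`, p. 13). Witness:
`modelTwist p`. [cite: MochizukiEtTh2009, §1 p.13] -/
theorem _root_.Literature.AnabelianGeometry.EtaleTheta.ThetaSetting.not_forall_ker_toEll_inf_GtpY_le_GtpYN :
    ¬ ∀ D : ThetaSetting p, D.IsEtThOrigin → D.Kdd = D.K →
      ∀ N, (D.thetaToEll.comp D.toTheta).ker ⊓ D.GtpY ≤ D.GtpYN N :=
  fun h => not_ker_toEll_inf_GtpY_le_GtpYN_modelTwist p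
    (h (ThetaSetting.modelTwist p) (ThetaSetting.modelTwist_isEtThOrigin p) (modelTwist_Kdd_eq p))

/-- **The bundle `Sec2Hyps` is not a theorem of the guarded root, even given "`K = K̈`"**:
`¬ ∀ D, D.IsEtThOrigin → D.Kdd = D.K → D.Sec2Hyps`. (Instances exist: `ThetaSetting.model_sec2Hyps`.)
[cite: MochizukiEtTh2009, Def 2.5 p.39] -/
theorem _root_.Literature.AnabelianGeometry.EtaleTheta.ThetaSetting.not_forall_sec2Hyps_of_isEtThOrigin :
    ¬ ∀ D : ThetaSetting p, D.IsEtThOrigin → D.Kdd = D.K → D.Sec2Hyps :=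
  fun h => ThetaSetting.not_sec2Hyps_modelTwist p
    (h (ThetaSetting.modelTwist p) (ThetaSetting.modelTwist_isEtThOrigin p) (modelTwist_Kdd_eq p))

/-- **Joint satisfiability census for clause (b)**: the guarded root with "`K = K̈`" admits BOTH a model of
clause (b) (abc-iut-L2-t1's `model p`, abc-iut-L2-d1) and a model of its negation (`modelTwist p`).
[cite: MochizukiEtTh2009, §1 p.13] -/
theorem _root_.Literature.AnabelianGeometry.EtaleTheta.ThetaSetting.kerClause_independent :
    (∃ D : ThetaSetting p, D.IsEtThOrigin ∧ D.Kdd = D.K ∧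
        ∀ N, (D.thetaToEll.comp D.toTheta).ker ⊓ D.GtpY ≤ D.GtpYN N) ∧
      ∃ D : ThetaSetting p, D.IsEtThOrigin ∧ D.Kdd = D.K ∧
        ¬ ∀ N, (D.thetaToEll.comp D.toTheta).ker ⊓ D.GtpY ≤ D.GtpYN N :=
  ⟨⟨ThetaSetting.model p, ThetaSetting.model_isEtThOrigin p, model_Kdd_eq p, ker_toEllM_inf_GtpY_le_YN p⟩,
    ⟨ThetaSetting.modelTwist p, ThetaSetting.modelTwist_isEtThOrigin p, modelTwist_Kdd_eq p,
      not_ker_toEll_inf_GtpY_le_GtpYN_modelTwist p⟩⟩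

end Literature.AnabelianGeometry.EtaleTheta.SettingModel

end
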